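import Summits.PneNP.PneNP.Theorems.SignDeg2Signing
import Summits.PneNP.PneNP.Theorems.Sd2BlSigningFP
import Summits.PneNP.PneNP.Theorems.SignDeg2AvoidAffineSplitFP

/-!
# K1'' CLOSED: `SignDeg2SigningFP k` — joint cut-norm signing for sign-degree-≤2 `k`-local maps at linear stretch
# is in FP, for EVERY locality `k` (cell pnp-ideate, ROUND-18 item K1'')

FRONTIER (a restricted-model algorithmic rung of the range-avoidance ladder: one polynomial-time signing machine per
`k`, certificate-producing, at stretch `m ≥ C(k)·n`); nothing here bears on P vs NP.

`SignDeg2Signing.SignDeg2SigningFP k` (pnp-ideate-p3, ROUND-17/18: `∃ C f, IsPolyTime f ∧ ∀ n m I (h : all tables of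
sign-degree ≤ 2), 0 < n → C·n ≤ m → SigCertified I (canonCert I h) (readOut m (f I.encode))`) is proved BY NAME with
`C = Sd2BlMachine.sd2C k` (`= 48·2400·ℓ²·s(s+1)·2^t`, `ℓ = max 3 (2·uniformW k 2)`, `t = 32 + 8ℓ`, `s = 2t`) and the machine
`f = Sd2BlMachine.sd2StrK k` (decode → certificate legs via the finite row tables `rowTable₂` → free splitting at block
length `4^t` → spot extraction → derandomised greedy signing by the method of conditional expectations on
`tr(A^{2^{j+2}})/A₁ + Σ_s ê_s/A₃`), whose output is SIGN-CERTIFIED (`Sd2BlMachine.sigCertified_sd2StrK`: the parametric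
sfm-bl pipeline `Sd2Bl.legBound_of_pipeline` + the K1'' interface `SignDeg2Legs.sigCertified_of_legBound`); polynomial time
by `Sd2BlMachine.isPolyTime_sd2StrK`.  `SignDeg2Signing.canonCert I h` is by definition the certificate
`certOfIntCert I le_rfl (fun j => certOf k 2 (I.table j) (h j))` of the closer.  Joint work of the cell pnp-ideate
(planner p3: statement, certificates, sign-degree tables; prover-1: the CAND machine (g8), affine split K3, the row table and
the dictionary D1/D2; prover-2: the sfm-bl B-module machine (g11/g12), S1, the parametric pipeline S2, the generic machine,
the closer).  Consequence (landed reductions): `SignDeg2OnlyAvoidLinearFP k` (`signDeg2OnlyAvoid_of_signingFP`) and, with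
prover-1's `AffineSplitFP.affineSplit`, `SignDeg2AvoidLinearFP k` for every `k` — the companion corollary file.
-/

set_option linter.dupNamespace false -- `Summit.PneNP.PneNP.…`: summit = sub-problem name (D-0017 single-conjunct layout)

namespace Summit.PneNP.PneNP.Theorems.Sd2BlMachine

open Literature.Computability.Complexity
open Summit.PneNP.PneNP.Theorems.SignDeg2Signing

/-- **K1'' (`SignDeg2SigningFP k`) for every locality `k`.** -/
theorem signDeg2SigningFP (k : ℕ) : SignDeg2SigningFP k :=
  ⟨sd2C k, sd2StrK k, isPolyTime_sd2StrK k, fun _ _ I h hn hm => sigCertified_sd2StrK I h hn hm⟩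

/-- **`SignDeg2OnlyAvoidLinearFP k`** (range avoidance for `k`-local maps with all tables of sign-degree `≤ 2`, at linear
stretch, is in FP) for every `k`, by the landed reduction `signDeg2OnlyAvoid_of_signingFP`. -/
theorem signDeg2OnlyAvoidLinearFP (k : ℕ) : SignDeg2OnlyAvoidLinearFP k :=
  signDeg2OnlyAvoid_of_signingFP k (signDeg2SigningFP k)

/-- **`SignDeg2AvoidLinearFP k`** — the proposed ROUND-18 TARGET (range avoidance at linear stretch for `k`-local maps
each of whose tables has sign-degree `≤ 2` OR is affine) for every `k`, from K1'' and prover-1's affine split K3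
(`AffineSplitFP.affineSplit`) through p3's `signDeg2Avoid_of_items`. -/
theorem signDeg2AvoidLinearFP (k : ℕ) : SignDeg2AvoidLinearFP k :=
  signDeg2Avoid_of_items k (signDeg2OnlyAvoidLinearFP k) (AffineSplitFP.affineSplit k)

end Summit.PneNP.PneNP.Theorems.Sd2BlMachine
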